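import Literature.NumberTheory.Transcendental.RoySmallValueStep4Orbit
import Literature.NumberTheory.Transcendental.RoySmallValueThresholds

/-!
# Route `RoyCriterion`, crux `RoySmallValueDirichletGap` (stmt-Schanuel-1050), line
# `two-sided-absorption-transfer` — helper lemmas for the stub `StubTwoSidedAbsorption`

Vocabulary-free helper lemmas for `RoyLinks.stub_twoSidedAbsorption` (two-sided strong absorption
of enemy links: Roy's Step-2 mass at ONE level `D` of an enemy link, propagated to every level `D'`
of the range `D^{1−δ/(τ−1)}/c ≤ D' ≤ c D^{1+δ/β}`, beats what Roy's Step 4 — Liouville, Prop. 4.2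
and the glue `Roy2013.step4_sum_max_ge'` — extracts at `D'` from an integer point of the body
`𝒞_{D'}` not vanishing on the link).  Contents:

* `eventually_absorb_big` — the largeness condition of the Step-4 glue at the level `n = D'`;
* `absorbConst_log_c4_nonneg`, `absorbConst_bounds` — the constant
  `log(4 · 3^{D'} e^{2D'^β} c₄^{D'})` of Step 4;
* `exists_absorbRange_const` — the constant `c = (12 C₁²)^{−1/(τ−1)}` of the range;
* `rpow_lower_of_absorbRange`, `lt_level_of_absorbRange` — the lower end of the range dominates the
  birth level `D*` of the link (`D* < D'`, `4C₁ D^{τ−1−δ} ≤ (D')^{τ−1}`);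
* `absorb_contra_up`, `absorb_contra_down` — the two pure-real contradictions (above / below `D`);
* `absorb_step4_points` — Roy's Step 4 for a finite set of points `P ⊂ ℂ³` (the tree's
  `ZeroConfigK.step4_orbit` freed from the orbit structure).

## References

* [Roy2013] D. Roy, *A small value estimate for 𝔾ₐ × 𝔾ₘ*, Mathematika 59 (2013), 333–363
  (arXiv:1301.0663), §7, Steps 2, 4, 5; Propositions 2.4, 4.2; Lemma 4.1.
-/

-- `Summit.Schanuel.Schanuel.…` is the mandated layout of this single-problem summit (CONVENTIONS §1).
set_option linter.dupNamespace false

noncomputable section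

namespace Summit.Schanuel.Schanuel.Theorems.RoyLinks

open Filter MvPolynomial Finset
open Literature.NumberTheory.Transcendental
open Literature.NumberTheory.Transcendental.Roy2013
open Literature.NumberTheory.Transcendental.Nesterenko

/-! ## Thresholds and constants -/

/-- **The largeness condition of the Step-4 glue at the level `n = D'`**:
`K + n (C₁ n^{1+β−τ}) + C₁ n^{2−τ} (n log 3 + 2 n^β) < n^{2+β−τ+δ}/2` eventually
(`τ ≥ 1`, `τ < β`, `δ > 0`).  [cite: Roy2013, §7, Step 4 ("if `D*` is large enough")] -/
theorem eventually_absorb_big {τ β δ : ℝ} (K C₁ : ℝ) (hτ1 : 1 ≤ τ) (hβ : τ < β) (hδ : 0 < δ) :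
    ∀ᶠ n : ℕ in atTop, K + (n : ℝ) * (C₁ * (n : ℝ) ^ (1 + β - τ)) +
        C₁ * (n : ℝ) ^ (2 - τ) * ((n : ℝ) * Real.log 3 + 2 * (n : ℝ) ^ β) <
      (n : ℝ) ^ (2 + β - τ + δ) / 2 := by
  have hν : 2 + β - τ < 2 + β - τ + δ := by linarith
  have h3τ : 3 - τ < 2 + β - τ + δ := by linarith
  have h0 : (0 : ℝ) < 2 + β - τ + δ := by linarith
  filter_upwards [eventually_term_le_div 0 (2 + β - τ + δ) K 0 (q := 20) (by norm_num) h0,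
    eventually_term_le_div (2 + β - τ) (2 + β - τ + δ) C₁ 0 (q := 20) (by norm_num) hν,
    eventually_term_le_div (3 - τ) (2 + β - τ + δ) (C₁ * Real.log 3) 0 (q := 20) (by norm_num) h3τ,
    eventually_term_le_div (2 + β - τ) (2 + β - τ + δ) (2 * C₁) 0 (q := 20) (by norm_num) hν,
    eventually_ge_atTop 1] with n e1 e2 e3 e4 hn
  have hx : (0 : ℝ) < n := by exact_mod_cast hn
  simp only [Real.rpow_zero, pow_zero, mul_one] at e1 e2 e3 e4
  have hpa : (n : ℝ) * (C₁ * (n : ℝ) ^ (1 + β - τ)) = C₁ * (n : ℝ) ^ (2 + β - τ) := by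
    rw [show (2 : ℝ) + β - τ = 1 + (1 + β - τ) by ring, Real.rpow_add hx, Real.rpow_one]; ring
  have hpb : (n : ℝ) ^ (2 - τ) * (n : ℝ) = (n : ℝ) ^ (3 - τ) := by
    rw [show (3 : ℝ) - τ = (2 - τ) + 1 by ring, Real.rpow_add hx, Real.rpow_one]
  have hpc : (n : ℝ) ^ (2 - τ) * (n : ℝ) ^ β = (n : ℝ) ^ (2 + β - τ) := by
    rw [show (2 : ℝ) + β - τ = (2 - τ) + β by ring, Real.rpow_add hx]
  have hexp : C₁ * (n : ℝ) ^ (2 - τ) * ((n : ℝ) * Real.log 3 + 2 * (n : ℝ) ^ β) =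
      C₁ * Real.log 3 * (n : ℝ) ^ (3 - τ) + 2 * C₁ * (n : ℝ) ^ (2 + β - τ) := by
    rw [← hpb, ← hpc]; ring
  rw [hpa, hexp]
  have hν0 : 0 < (n : ℝ) ^ (2 + β - τ + δ) := Real.rpow_pos_of_pos hx _
  linarith

/-- `log c₄ ≥ 0` (`c₄ ≥ c₂ e^{2c₂²} ≥ 1`). [folklore] -/
theorem absorbConst_log_c4_nonneg (ξ η : ℂ) : 0 ≤ Real.log (roy_c4 ξ η) := by
  refine Real.log_nonneg ?_
  have hc := one_le_roy_c2 ξ η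
  have e1 : (1 : ℝ) * 1 ≤ roy_c2 ξ η * Real.exp (2 * roy_c2 ξ η ^ 2) :=
    mul_le_mul hc (Real.one_le_exp (by positivity)) zero_le_one (by linarith)
  have e2 : (0 : ℝ) ≤ roy_A ξ η := by rw [roy_A]; positivity
  rw [roy_c4]; linarith

/-- **The constant of Step 4 at the level `D'`**: with `M = 3^{D'} e^{2(D')^β} c₄^{D'}`,
`0 ≤ log(4M)` and `(D' log 3 + 2(D')^β) + log(4M) ≤ 6 (D')^β` as soon as
`2D' log 3 + log 4 + D' log c₄ ≤ 2 (D')^β` (threshold (c)). [cite: Roy2013, §7, Step 4] -/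
theorem absorbConst_bounds {ξ η : ℂ} {β : ℝ} {D' : ℕ}
    (hconst : 2 * (D' : ℝ) * Real.log 3 + Real.log 4 + (D' : ℝ) * Real.log (roy_c4 ξ η) ≤
      2 * (D' : ℝ) ^ β) :
    0 ≤ Real.log (4 * (3 ^ D' * Real.exp (2 * (D' : ℝ) ^ β) * roy_c4 ξ η ^ D')) ∧
    (D' : ℝ) * Real.log 3 + 2 * (D' : ℝ) ^ β +
      Real.log (4 * (3 ^ D' * Real.exp (2 * (D' : ℝ) ^ β) * roy_c4 ξ η ^ D')) ≤
        6 * (D' : ℝ) ^ β := by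
  have hc₄ := roy_c4_pos ξ η
  have hM : Real.log (4 * (3 ^ D' * Real.exp (2 * (D' : ℝ) ^ β) * roy_c4 ξ η ^ D')) =
      Real.log 4 + D' * Real.log 3 + 2 * (D' : ℝ) ^ β + D' * Real.log (roy_c4 ξ η) := by
    rw [Real.log_mul (by norm_num) (by positivity), Real.log_mul (by positivity) (by positivity),
      Real.log_mul (by positivity) (by positivity), Real.log_pow, Real.log_exp, Real.log_pow]
    ring
  have hc4 := absorbConst_log_c4_nonneg ξ η
  have hlog4 : 0 ≤ Real.log 4 := Real.log_nonneg (by norm_num)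
  have hlog3 : 0 < Real.log 3 := Real.log_pos (by norm_num)
  rw [hM]
  exact ⟨by positivity, by linarith⟩

/-- **The constant of the range.** For `1 < τ < 2` and `C₁ ≥ 1` there is `c > 0` with
`c ≤ 1/(12 C₁)` and `12 C₁² c^{τ−1} = 1` (namely `c = (12C₁²)^{−1/(τ−1)}`). [folklore] -/
theorem exists_absorbRange_const {τ C₁ : ℝ} (h1 : 1 < τ) (h2 : τ < 2) (hC1 : 1 ≤ C₁) :
    ∃ c : ℝ, 0 < c ∧ c ≤ 1 / (12 * C₁) ∧ 12 * C₁ ^ 2 * c ^ (τ - 1) = 1 := by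
  have hτ10 : 0 < τ - 1 := by linarith
  have h12 : (1 : ℝ) ≤ 12 * C₁ ^ 2 := by nlinarith
  obtain ⟨K, hK⟩ : ∃ K : ℝ, K = (12 * C₁ ^ 2) ^ (τ - 1)⁻¹ := ⟨_, rfl⟩
  have hK12 : 12 * C₁ ^ 2 ≤ K := by
    rw [hK]
    calc 12 * C₁ ^ 2 = (12 * C₁ ^ 2) ^ (1 : ℝ) := (Real.rpow_one _).symm
      _ ≤ (12 * C₁ ^ 2) ^ (τ - 1)⁻¹ :=
        Real.rpow_le_rpow_of_exponent_le h12 ((one_le_inv₀ hτ10).mpr (by linarith))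
  have hK0 : 0 < K := by linarith
  have hKpow : K ^ (τ - 1) = 12 * C₁ ^ 2 := by
    rw [hK, Real.rpow_inv_rpow (by positivity) hτ10.ne']
  refine ⟨K⁻¹, inv_pos.mpr hK0, ?_, ?_⟩
  · rw [inv_eq_one_div]; exact one_div_le_one_div_of_le (by positivity) (by nlinarith)
  · rw [Real.inv_rpow hK0.le, hKpow, mul_inv_cancel₀ (by positivity)]

/-! ## The lower end of the range -/

/-- From `D^{1−δ/(τ−1)}/c ≤ D'` (`τ > 1`, `c > 0`) and `A c^{τ−1} ≤ 1`, `A ≥ 0`: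
`A · D^{τ−1−δ} ≤ (D')^{τ−1}`. [folklore] -/
theorem rpow_lower_of_absorbRange {τ δ c A D D' : ℝ} (hτ1 : 1 < τ) (hc0 : 0 < c) (hA0 : 0 ≤ A)
    (hA : A * c ^ (τ - 1) ≤ 1) (hD : 0 ≤ D) (hD' : 0 ≤ D')
    (hlo : D ^ (1 - δ / (τ - 1)) / c ≤ D') : A * D ^ (τ - 1 - δ) ≤ D' ^ (τ - 1) := by
  have hτ0 : 0 < τ - 1 := by linarith
  have hτne : τ - 1 ≠ 0 := hτ0.ne'
  have h1 : D ^ (1 - δ / (τ - 1)) ≤ D' * c := (div_le_iff₀ hc0).mp hlo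
  have h2 : (D ^ (1 - δ / (τ - 1))) ^ (τ - 1) ≤ (D' * c) ^ (τ - 1) :=
    Real.rpow_le_rpow (Real.rpow_nonneg hD _) h1 hτ0.le
  rw [← Real.rpow_mul hD, Real.mul_rpow hD' hc0.le] at h2
  have e : (1 - δ / (τ - 1)) * (τ - 1) = τ - 1 - δ := by field_simp
  rw [e] at h2
  calc A * D ^ (τ - 1 - δ) ≤ A * (D' ^ (τ - 1) * c ^ (τ - 1)) := mul_le_mul_of_nonneg_left h2 hA0
    _ = (A * c ^ (τ - 1)) * D' ^ (τ - 1) := by ring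
    _ ≤ 1 * D' ^ (τ - 1) := mul_le_mul_of_nonneg_right hA (Real.rpow_nonneg hD' _)
    _ = D' ^ (τ - 1) := one_mul _

/-- **The level `D'` dominates the birth level `D*` of the link.** From the lower end of the range
`D^{1−δ/(τ−1)}/c ≤ D'` with `12 C₁² c^{τ−1} ≤ 1` and Step 5 (ii), `(D*)^{τ−1} ≤ 3C₁² D^{τ−1−δ}`
(`IsLink.rpow_Ds_le`): `D* < D'` and `4C₁ D^{τ−1−δ} ≤ (D')^{τ−1}`. [cite: Roy2013, §7, Step 5] -/
theorem lt_level_of_absorbRange {τ δ c C₁ D D' Ds : ℝ} (h1 : 1 < τ) (hc0 : 0 < c) (hC1 : 1 ≤ C₁)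
    (hcpow : 12 * C₁ ^ 2 * c ^ (τ - 1) ≤ 1) (hD : 0 < D) (hD' : 0 ≤ D') (hDs : 0 ≤ Ds)
    (hlo : D ^ (1 - δ / (τ - 1)) / c ≤ D')
    (hDs_le : Ds ^ (τ - 1) ≤ 3 * C₁ ^ 2 * D ^ (τ - 1 - δ)) :
    Ds < D' ∧ 4 * C₁ * D ^ (τ - 1 - δ) ≤ D' ^ (τ - 1) := by
  have hτ10 : 0 < τ - 1 := by linarith
  have hlo' : 12 * C₁ ^ 2 * D ^ (τ - 1 - δ) ≤ D' ^ (τ - 1) :=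
    rpow_lower_of_absorbRange h1 hc0 (by positivity) hcpow hD.le hD' hlo
  have hDτ : 0 < D ^ (τ - 1 - δ) := Real.rpow_pos_of_pos hD _
  have hpos : 0 < C₁ ^ 2 * D ^ (τ - 1 - δ) := by positivity
  refine ⟨?_, ?_⟩
  · have hlt : Ds ^ (τ - 1) < D' ^ (τ - 1) := by linarith
    exact (Real.rpow_lt_rpow_iff hDs hD' hτ10).mp hlt
  · have : 4 * C₁ ≤ 12 * C₁ ^ 2 := by nlinarith
    exact (mul_le_mul_of_nonneg_right this hDτ.le).trans hlo'

/-! ## The two pure-real contradictions -/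

/-- **Above `D` (`ρ = 1`)**: for `D' ≤ c D^{1+δ/β}` with `c ≤ 1/(12C₁)`, `C₁ ≥ 1`, `β ≥ 1`,
`D ≥ 1`, `d ≥ 1`, `h ≥ 0`: `D' h + 6 d (D')^β < (D^δ/C₁)(D^β d + D h)`.
[cite: Roy2013, §7, Step 5 (the bookkeeping); card two-sided-absorption-transfer] -/
theorem absorb_contra_up {β δ C₁ c D D' d h : ℝ} (hC1 : 1 ≤ C₁) (hc0 : 0 < c)
    (hc : c ≤ 1 / (12 * C₁)) (hβ1 : 1 ≤ β) (hδ : 0 < δ) (hD : 1 ≤ D) (hD' : 0 ≤ D')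
    (hhi : D' ≤ c * D ^ (1 + δ / β)) (hd : 1 ≤ d) (hh : 0 ≤ h) :
    D' * h + 6 * d * D' ^ β < D ^ δ / C₁ * (D ^ β * d + D * h) := by
  have hD0 : 0 < D := by linarith
  have hC0 : 0 < C₁ := by linarith
  have hβ0 : 0 < β := by linarith
  have hd0 : 0 < d := by linarith
  have hβne : β ≠ 0 := hβ0.ne'
  have hc1 : c ≤ 1 := hc.trans (by rw [div_le_one (by positivity)]; linarith)
  -- `(D')^β ≤ c D^β D^δ`
  have e1 : (D ^ (1 + δ / β)) ^ β = D ^ β * D ^ δ := by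
    rw [← Real.rpow_mul hD0.le, ← Real.rpow_add hD0]; congr 1; field_simp
  have hcβ : c ^ β ≤ c := by
    calc c ^ β ≤ c ^ (1 : ℝ) := Real.rpow_le_rpow_of_exponent_ge hc0 hc1 hβ1
      _ = c := Real.rpow_one c
  have hD'β : D' ^ β ≤ c * (D ^ β * D ^ δ) := by
    calc D' ^ β ≤ (c * D ^ (1 + δ / β)) ^ β := Real.rpow_le_rpow hD' hhi hβ0.le
      _ = c ^ β * (D ^ β * D ^ δ) := by rw [Real.mul_rpow hc0.le (Real.rpow_nonneg hD0.le _), e1]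
      _ ≤ c * (D ^ β * D ^ δ) := mul_le_mul_of_nonneg_right hcβ (by positivity)
  -- `D' ≤ c D^δ D`
  have hD'le : D' ≤ c * (D ^ δ * D) := by
    calc D' ≤ c * D ^ (1 + δ / β) := hhi
      _ ≤ c * D ^ (1 + δ) := by
        refine mul_le_mul_of_nonneg_left (Real.rpow_le_rpow_of_exponent_le hD ?_) hc0.le
        have : δ / β ≤ δ := div_le_self hδ.le hβ1
        linarith
      _ = c * (D ^ δ * D) := by rw [add_comm, Real.rpow_add_one hD0.ne']
  -- compare, after multiplying by `C₁`
  have t1 : 6 * d * D' ^ β ≤ 6 * d * (c * (D ^ β * D ^ δ)) :=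
    mul_le_mul_of_nonneg_left hD'β (by positivity)
  have t2 : D' * h ≤ c * (D ^ δ * D) * h := mul_le_mul_of_nonneg_right hD'le hh
  have t3 : c * C₁ ≤ 1 / 12 := by
    calc c * C₁ ≤ 1 / (12 * C₁) * C₁ := mul_le_mul_of_nonneg_right hc hC0.le
      _ = 1 / 12 := by field_simp
  have t4 : (D' * h + 6 * d * D' ^ β) * C₁ ≤
      (c * C₁) * (D ^ δ * D * h + 6 * d * (D ^ β * D ^ δ)) := by
    calc (D' * h + 6 * d * D' ^ β) * C₁
        ≤ (c * (D ^ δ * D) * h + 6 * d * (c * (D ^ β * D ^ δ))) * C₁ :=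
          mul_le_mul_of_nonneg_right (add_le_add t2 t1) hC0.le
      _ = (c * C₁) * (D ^ δ * D * h + 6 * d * (D ^ β * D ^ δ)) := by ring
  have t5 : (c * C₁) * (D ^ δ * D * h + 6 * d * (D ^ β * D ^ δ)) ≤
      1 / 12 * (D ^ δ * D * h + 6 * d * (D ^ β * D ^ δ)) :=
    mul_le_mul_of_nonneg_right t3 (by positivity)
  have hA : 0 < D ^ β * D ^ δ * d := by positivity
  have hB : 0 ≤ D ^ δ * D * h := by positivity
  rw [div_mul_eq_mul_div, lt_div_iff₀ hC0]
  linarith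

/-- **Below `D` (`ρ = T'/T`)**: for `1 ≤ D' ≤ D`, `4C₁ D^{τ−1−δ} ≤ (D')^{τ−1}` (the lower end of
the range), `24 C₁ ≤ D^δ`, `C₁ ≥ 1`, `τ ≤ β`, `d ≥ 1`, `h ≥ 0`, `0 < T ≤ D^τ`, `0 < T'`,
`(D')^τ ≤ 2T'`: `D' h + 6 d (D')^β < (T'/T) · (D^δ/C₁)(D^β d + D h)`.
[cite: Roy2013, §7, Step 5 (the bookkeeping); card two-sided-absorption-transfer] -/
theorem absorb_contra_down {τ β δ C₁ D D' d h T T' : ℝ} (hτβ : τ ≤ β)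
    (hC1 : 1 ≤ C₁) (hD : 1 ≤ D) (hD'1 : 1 ≤ D') (hD'D : D' ≤ D)
    (hlo : 4 * C₁ * D ^ (τ - 1 - δ) ≤ D' ^ (τ - 1)) (hlarge : 24 * C₁ ≤ D ^ δ)
    (hd : 1 ≤ d) (hh : 0 ≤ h) (hT0 : 0 < T) (hT : T ≤ D ^ τ) (hT'0 : 0 < T')
    (hT' : D' ^ τ ≤ 2 * T') :
    D' * h + 6 * d * D' ^ β < T' / T * (D ^ δ / C₁ * (D ^ β * d + D * h)) := by
  have hD0 : 0 < D := by linarith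
  have hD'0 : 0 < D' := by linarith
  have hC0 : 0 < C₁ := by linarith
  have hd0 : 0 < d := by linarith
  have hDτ : 0 < D ^ τ := Real.rpow_pos_of_pos hD0 τ
  -- `T'/T ≥ (D')^τ / (2 D^τ)`
  have hr : D' ^ τ / (2 * D ^ τ) ≤ T' / T := by
    rw [div_le_div_iff₀ (by positivity) hT0]
    calc D' ^ τ * T ≤ 2 * T' * T := mul_le_mul_of_nonneg_right hT' hT0.le
      _ ≤ 2 * T' * D ^ τ := mul_le_mul_of_nonneg_left hT (by positivity)
      _ = T' * (2 * D ^ τ) := by ring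
  have hM0 : 0 ≤ D ^ δ / C₁ * (D ^ β * d + D * h) := by positivity
  have hmain : D' * h + 6 * d * D' ^ β <
      D' ^ τ / (2 * D ^ τ) * (D ^ δ / C₁ * (D ^ β * d + D * h)) := by
    rw [show D' ^ τ / (2 * D ^ τ) * (D ^ δ / C₁ * (D ^ β * d + D * h)) =
        D' ^ τ * D ^ δ * (D ^ β * d + D * h) / (2 * D ^ τ * C₁) by
      field_simp]
    rw [lt_div_iff₀ (by positivity)]
    -- the `h`-terms
    have hh' : 4 * C₁ * D ^ τ * D' * h ≤ D' ^ τ * D ^ δ * D * h := by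
      refine mul_le_mul_of_nonneg_right ?_ hh
      have e1 : D ^ (τ - 1 - δ) * D ^ (1 + δ) = D ^ τ := by
        rw [← Real.rpow_add hD0]; ring_nf
      have e2 : D' ^ (τ - 1) * D' = D' ^ τ := by
        rw [← Real.rpow_add_one hD'0.ne', sub_add_cancel]
      have e3 : D ^ δ * D = D ^ (1 + δ) := by
        rw [add_comm, Real.rpow_add_one hD0.ne']
      calc 4 * C₁ * D ^ τ * D' = (4 * C₁ * D ^ (τ - 1 - δ)) * (D ^ (1 + δ) * D') := by
            rw [← e1]; ring
        _ ≤ D' ^ (τ - 1) * (D ^ (1 + δ) * D') := mul_le_mul_of_nonneg_right hlo (by positivity)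
        _ = D' ^ τ * D ^ δ * D := by rw [← e2, ← e3]; ring
    -- the `d`-terms
    have hd' : 24 * C₁ * D ^ τ * D' ^ β * d ≤ D' ^ τ * D ^ δ * D ^ β * d := by
      refine mul_le_mul_of_nonneg_right ?_ hd0.le
      have e4 : D' ^ β = D' ^ τ * D' ^ (β - τ) := by rw [← Real.rpow_add hD'0]; ring_nf
      have e5 : D ^ τ * D ^ (β - τ) = D ^ β := by rw [← Real.rpow_add hD0]; ring_nf
      have hβτ : D' ^ (β - τ) ≤ D ^ (β - τ) := Real.rpow_le_rpow hD'0.le hD'D (by linarith)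
      calc 24 * C₁ * D ^ τ * D' ^ β = 24 * C₁ * D' ^ τ * (D ^ τ * D' ^ (β - τ)) := by
            rw [e4]; ring
        _ ≤ 24 * C₁ * D' ^ τ * (D ^ τ * D ^ (β - τ)) := by gcongr
        _ = 24 * C₁ * (D' ^ τ * D ^ β) := by rw [e5]; ring
        _ ≤ D ^ δ * (D' ^ τ * D ^ β) := mul_le_mul_of_nonneg_right hlarge (by positivity)
        _ = D' ^ τ * D ^ δ * D ^ β := by ring
    have hposd : 0 < D' ^ τ * D ^ δ * D ^ β * d := by positivity
    have hposh : 0 ≤ D' ^ τ * D ^ δ * D * h := by positivity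
    linarith
  calc D' * h + 6 * d * D' ^ β < _ := hmain
    _ ≤ T' / T * (D ^ δ / C₁ * (D ^ β * d + D * h)) := mul_le_mul_of_nonneg_right hr hM0

/-! ## Roy's Step 4 for a finite set of points -/

/-- **Roy 2013, §7, Step 4, for a finite set of points `P ⊂ ℂ³`** (all `p ≠ 0`): for an integer
form `R` whose complexification lies in Roy's body `royBody D' ξ η Y U T'` and which vanishes at no
point of `P`, the Liouville inequality `0 ≤ D' h + ∑_{p∈P} log(|R(p)|/‖p‖^{D'})`, the crude bound
`|R(u_p)| ≤ 3^{D'} e^Y` and Prop. 4.2 at the sup-normalised representatives `u_p` of the points of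
`𝒮 ⊆ P ∩ 𝒰` give, under `log 2 + 2c₂² − U < −(D' h + #P (D' log 3 + Y))`,
`∑_{p∈𝒮} max{T' log dist(u_p,(1:γ)), b_p} ≥
  −(D' h + #P (D' log 3 + Y) + #𝒮 log(4·3^{D'} e^Y c₄^{D'}))`
with the honest second coordinate `b_p` (the tree's `ZeroConfigK.step4_orbit`, freed from the
orbit structure via `step4_sum_max_ge'`). [cite: Roy2013, §7, Step 4; Prop. 4.2; Lemma 4.1] -/
theorem absorb_step4_points {ξ η : ℂ} {P S : Finset (Fin 3 → ℂ)} {D' T' : ℕ} {Y U h : ℝ}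
    {R : MvPolynomial (Fin 3) ℤ}
    (hRmem : map (Int.castRingHom ℂ) R ∈ royBody D' ξ η Y U T')
    (hP0 : ∀ p ∈ P, p ≠ 0) (hall : ∀ p ∈ P, aeval p R ≠ 0)
    (hLio : 0 ≤ D' * h + ∑ p ∈ P, Real.log (‖aeval p R‖ / ‖p‖ ^ D'))
    (hSP : S ⊆ P) (hSU : ∀ p ∈ S, pdist ξ η (supNormalise p) ≤ (2 * roy_c2 ξ η)⁻¹)
    (hSd : ∀ p ∈ S, 0 < pdist ξ η (supNormalise p)) (hY : 0 ≤ D' * Real.log 3 + Y)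
    (hbig : Real.log 2 + 2 * roy_c2 ξ η ^ 2 - U < -(D' * h + #P * (D' * Real.log 3 + Y))) :
    -(D' * h + #P * (D' * Real.log 3 + Y) +
        #S * Real.log (4 * (3 ^ D' * Real.exp Y * roy_c4 ξ η ^ D'))) ≤
      ∑ p ∈ S, max (T' * Real.log (pdist ξ η (supNormalise p)))
        (if 0 < adist ξ η (supNormalise p) then Real.log (adist ξ η (supNormalise p))
          else T' * Real.log (pdist ξ η (supNormalise p))) := by
  have hval : ∀ p : Fin 3 → ℂ, aeval p (map (Int.castRingHom ℂ) R) = aeval p R := fun p => by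
    rw [← algebraMap_int_eq, aeval_map_algebraMap]
  -- the values `y_p = |R(u_p)| = |R(p)| / ‖p‖^{D'}`
  obtain ⟨y, hy⟩ : ∃ y : (Fin 3 → ℂ) → ℝ,
      y = fun p => ‖eval (supNormalise p) (map (Int.castRingHom ℂ) R)‖ := ⟨_, rfl⟩
  have hyeq : ∀ p, y p = ‖aeval p R‖ / ‖p‖ ^ D' := fun p => by
    rw [hy]; simp only
    rw [norm_eval_supNormalise hRmem.1, show (eval p (map (Int.castRingHom ℂ) R) : ℂ) =
      aeval p (map (Int.castRingHom ℂ) R) from rfl, hval]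
  have hypos : ∀ p ∈ P, 0 < y p := fun p hp => by
    rw [hyeq]
    exact div_pos (norm_pos_iff.mpr (hall p hp)) (pow_pos (norm_pos_iff.mpr (hP0 p hp)) _)
  have hL : 0 ≤ D' * h + ∑ p ∈ P, Real.log (y p) := by simp only [hyeq]; exact hLio
  have hsup1 : ∀ p ∈ P, ∀ i, ‖supNormalise p i‖ ≤ 1 := fun p hp i =>
    supNormalise_le_one (hP0 p hp) i
  -- the crude bound
  have hC : ∀ p ∈ P, Real.log (y p) ≤ D' * Real.log 3 + Y := by
    intro p hp
    have h1 : y p ≤ 3 ^ D' * Real.exp Y := by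
      rw [hy]; exact norm_eval_le_of_mem_royBody hRmem (hsup1 p hp)
    have h2 := Real.log_le_log (hypos p hp) h1
    rwa [Real.log_mul (by positivity) (Real.exp_pos Y).ne', Real.log_pow, Real.log_exp] at h2
  -- Prop. 4.2 at the points of `S`
  have hvalS : ∀ p ∈ S, y p ≤ Real.exp (2 * roy_c2 ξ η ^ 2) * Real.exp (-U) +
      (3 ^ D' * Real.exp Y * roy_c4 ξ η ^ D') *
        (pdist ξ η (supNormalise p) ^ T' + adist ξ η (supNormalise p)) := by
    intro p hp
    have hpP := hSP hp
    have hu1 := exists_one_le_supNormalise (hP0 p hpP)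
    have hu0 : (2 * roy_c2 ξ η)⁻¹ ≤ ‖supNormalise p 0‖ := lemma_4_1 hu1 (hSU p hp)
    have h := prop_4_2 (T := T') hRmem.1 (hsup1 p hpP) hu0 (hSU p hp) (Real.exp_pos (-U)).le
      (fun n hn => hRmem.2.2 n hn)
    rw [hy]
    refine h.trans (add_le_add le_rfl (mul_le_mul_of_nonneg_right ?_ ?_))
    · calc l1Norm (map (Int.castRingHom ℂ) R) * roy_c4 ξ η ^ D'
          ≤ (3 ^ D' * Real.exp Y) * roy_c4 ξ η ^ D' := by
            refine mul_le_mul_of_nonneg_right ?_ (pow_nonneg (roy_c4_pos ξ η).le _)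
            calc l1Norm (map (Int.castRingHom ℂ) R) ≤ _ := l1Norm_le_card_mul_maxNorm _
              _ ≤ 3 ^ D' * Real.exp Y := by
                refine mul_le_mul ?_ hRmem.2.1 (maxNorm_nonneg _) (by positivity)
                exact_mod_cast card_support_le_pow_of_isHomogeneous hRmem.1
      _ = 3 ^ D' * Real.exp Y * roy_c4 ξ η ^ D' := by ring
    · exact add_nonneg (pow_nonneg (pdist_nonneg _ _ _) _) (adist_nonneg _ _ _)
  have hM : 0 < 3 ^ D' * Real.exp Y * roy_c4 ξ η ^ D' := by
    have := roy_c4_pos ξ η; positivity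
  have hlog2 : Real.log (2 * (Real.exp (2 * roy_c2 ξ η ^ 2) * Real.exp (-U))) =
      Real.log 2 + 2 * roy_c2 ξ η ^ 2 - U := by
    rw [Real.log_mul two_ne_zero (mul_pos (Real.exp_pos _) (Real.exp_pos _)).ne',
      Real.log_mul (Real.exp_pos _).ne' (Real.exp_pos _).ne', Real.log_exp, Real.log_exp]
    ring
  exact step4_sum_max_ge' hSP y (fun p => pdist ξ η (supNormalise p))
    (fun p => adist ξ η (supNormalise p))
    (fun p => if 0 < adist ξ η (supNormalise p) then Real.log (adist ξ η (supNormalise p))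
      else T' * Real.log (pdist ξ η (supNormalise p))) T' hypos hL hC hY
    (mul_pos (Real.exp_pos _) (Real.exp_pos _)) hM hSd (fun p _ => adist_nonneg _ _ _)
    (fun p _ hq => by simp only [hq, if_true]; exact le_rfl) hvalS (by rw [hlog2]; exact hbig)

end Summit.Schanuel.Schanuel.Theorems.RoyLinks

end
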